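import Mathlib
import Summits.MatrixMultiplication.MatrixMultiplication.Theorems.SubgroupIdentityDesigns.Negative.WitnessPairBound
import Summits.MatrixMultiplication.MatrixMultiplication.Theorems.SubgroupIdentityDesigns.Negative.LevelOneFloor

/-!
# The projective-line bound (all `p`)

Route `LevelGradedCohnUmans`, crux `SubgroupIdentityDesigns`, the `(m,k) = (2,1)` cell.

**Projective-line bound** (`card_le_succ_mul_card_upper`): for every subgroup `S ≤ GL₂(𝔽_p)` the
upper-triangular part `S ∩ B⁺` (the stabiliser of the line `⟨e₁⟩`) has index at most `p + 1`:
`|S| ≤ (p+1)·|S ∩ B⁺|` (the orbit of `⟨e₁⟩` in `P¹(𝔽_p)` has at most `p + 1` points).  The proof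
is elementary: `s ↦ (slope of the first column of s, r⁻¹ s)` with `r` a chosen representative of
the slope class is injective into `Option 𝔽_p × (S ∩ B⁺)`.  `exists_upper_part` packages
`S ∩ B⁺` as a subgroup, and two floor inequalities (`p²(p²-1) ≤ f(3)` for `p ≥ 3`,
`p(p+1)²(p-1) ≤ f(3)` for `p ≥ 5`, `f(3) = 1 + p³ + (p-2)(p+1)³` the level-one floor of
`LevelOneFloor`) are recorded for the volume laws built on the torus budget
(`TorusBudget.torus_budget`: design ⇒ `|D₁||D₂||S'| ≤ p - 1`), which turn the index bound into
`V ≤ p²(p²-1)` (two `p`-members) and `V ≤ p(p+1)²(p-1)` (one `p`-member in front) — below the floor.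

VALUE = THEOREM (all `p`), NOT summit progress; the crux item stmt-MatrixMultiplication-14079 is
untouched and remains open.
-/

set_option linter.dupNamespace false

noncomputable section

open scoped BigOperators Classical

open Summit.MatrixMultiplication.MatrixMultiplication.Theorems.LieRankDesigns.Negative (GLm Mat)

namespace Summit.MatrixMultiplication.MatrixMultiplication.Theorems.SubgroupIdentityDesigns.Negative

section ProjectiveLine

open Literature.Barriers.MatrixMultiplication (SubgroupTPP)

variable {p : ℕ} [hp : Fact p.Prime]

/-- Equal first-column slopes mean proportional first columns. -/
theorem prop_of_slope_eq (s t : GLm p 2)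
    (h : (if (s : Mat p 2) 1 0 = 0 then none
          else some ((s : Mat p 2) 0 0 * ((s : Mat p 2) 1 0)⁻¹) : Option (ZMod p)) =
        (if (t : Mat p 2) 1 0 = 0 then none
          else some ((t : Mat p 2) 0 0 * ((t : Mat p 2) 1 0)⁻¹))) :
    (s : Mat p 2) 0 0 * (t : Mat p 2) 1 0 = (s : Mat p 2) 1 0 * (t : Mat p 2) 0 0 := by
  by_cases h1 : (s : Mat p 2) 1 0 = 0 <;> by_cases h2 : (t : Mat p 2) 1 0 = 0
  · rw [h1, h2, mul_zero, zero_mul]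
  · rw [if_pos h1, if_neg h2] at h
    exact (Option.some_ne_none _ h.symm).elim
  · rw [if_neg h1, if_pos h2] at h
    exact (Option.some_ne_none _ h).elim
  · rw [if_neg h1, if_neg h2] at h
    have h' := Option.some_injective _ h
    calc (s : Mat p 2) 0 0 * (t : Mat p 2) 1 0
        = (s : Mat p 2) 0 0 * ((s : Mat p 2) 1 0)⁻¹ * (s : Mat p 2) 1 0 * (t : Mat p 2) 1 0 := by
          rw [inv_mul_cancel_right₀ h1]
      _ = (t : Mat p 2) 0 0 * ((t : Mat p 2) 1 0)⁻¹ * (s : Mat p 2) 1 0 * (t : Mat p 2) 1 0 := by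
          rw [h']
      _ = (s : Mat p 2) 1 0 * (t : Mat p 2) 0 0 := by
          rw [mul_comm ((t : Mat p 2) 0 0 * ((t : Mat p 2) 1 0)⁻¹) ((s : Mat p 2) 1 0),
            mul_assoc, inv_mul_cancel_right₀ h2]

/-- Proportional first columns: the quotient `r⁻¹ s` is upper-triangular. -/
theorem quot_upper_of_prop {r s : GLm p 2}
    (hprop : (r : Mat p 2) 0 0 * (s : Mat p 2) 1 0 = (r : Mat p 2) 1 0 * (s : Mat p 2) 0 0) :
    ((r⁻¹ * s : GLm p 2) : Mat p 2) 1 0 = 0 := by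
  have hdet := Matrix.GeneralLinearGroup.det_ne_zero r
  rw [Matrix.det_fin_two] at hdet
  generalize hq : r⁻¹ * s = q
  have hs : s = r * q := by rw [← hq]; group
  subst hs
  simp only [Units.val_mul, Matrix.mul_apply, Fin.sum_univ_two] at hprop
  have key : ((r : Mat p 2) 0 0 * (r : Mat p 2) 1 1 - (r : Mat p 2) 0 1 * (r : Mat p 2) 1 0) *
      (q : Mat p 2) 1 0 = 0 := by
    linear_combination hprop
  exact (mul_eq_zero.mp key).resolve_left hdet

/-- **Projective-line bound.**  If `S'` contains every upper-triangular element of `S`, then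
`|S| ≤ (p + 1)·|S'|` (index of the stabiliser of `⟨e₁⟩` is the orbit size `≤ |P¹(𝔽_p)| = p + 1`). -/
theorem card_le_succ_mul_card_upper (S S' : Subgroup (GLm p 2))
    (hS' : ∀ s ∈ S, (s : Mat p 2) 1 0 = 0 → s ∈ S') : Nat.card S ≤ (p + 1) * Nat.card S' := by
  let ℓ : GLm p 2 → Option (ZMod p) := fun s =>
    if (s : Mat p 2) 1 0 = 0 then none else some ((s : Mat p 2) 0 0 * ((s : Mat p 2) 1 0)⁻¹)
  let rep : Option (ZMod p) → GLm p 2 := fun v =>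
    if h : ∃ s : S, ℓ (s : GLm p 2) = v then ((Classical.choose h : S) : GLm p 2) else 1
  have hrep : ∀ s : S, rep (ℓ s) ∈ S ∧ ℓ (rep (ℓ s)) = ℓ s := by
    intro s
    have h : ∃ s' : S, ℓ (s' : GLm p 2) = ℓ s := ⟨s, rfl⟩
    simp only [rep, dif_pos h]
    exact ⟨(Classical.choose h).2, Classical.choose_spec h⟩
  have hmem : ∀ s : S, (rep (ℓ s))⁻¹ * (s : GLm p 2) ∈ S' := fun s =>
    hS' _ (S.mul_mem (S.inv_mem (hrep s).1) s.2)
      (quot_upper_of_prop (prop_of_slope_eq _ _ (hrep s).2))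
  let g : S → Option (ZMod p) × S' := fun s => (ℓ s, ⟨_, hmem s⟩)
  have hinj : Function.Injective g := by
    intro s t hst
    simp only [g, Prod.mk.injEq, Subtype.mk.injEq] at hst
    obtain ⟨h1, h2⟩ := hst
    rw [h1] at h2
    exact Subtype.ext (mul_left_cancel h2)
  have hcard := Nat.card_le_card_of_injective g hinj
  rwa [Nat.card_prod, Nat.card_eq_fintype_card (α := Option (ZMod p)), Fintype.card_option,
    ZMod.card] at hcard

/-- The upper-triangular part of a subgroup, as a subgroup. -/
theorem exists_upper_part (H : Subgroup (GLm p 2)) :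
    ∃ S' : Subgroup (GLm p 2), S' ≤ H ∧ (∀ s ∈ S', (s : Mat p 2) 1 0 = 0) ∧
      ∀ s ∈ H, (s : Mat p 2) 1 0 = 0 → s ∈ S' := by
  refine ⟨{ carrier := {s | s ∈ H ∧ (s : Mat p 2) 1 0 = 0},
            mul_mem' := ?_, one_mem' := ?_, inv_mem' := ?_ }, ?_, ?_, ?_⟩
  · rintro a b ⟨ha, ha0⟩ ⟨hb, hb0⟩
    refine ⟨H.mul_mem ha hb, ?_⟩
    simp [Units.val_mul, Matrix.mul_apply, Fin.sum_univ_two, ha0, hb0]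
  · exact ⟨H.one_mem, by simp⟩
  · rintro a ⟨ha, ha0⟩
    refine ⟨H.inv_mem ha, ?_⟩
    have e1 : ((a⁻¹ * a : GLm p 2) : Mat p 2) 1 0 = 0 := by simp
    have e : ((a⁻¹ : GLm p 2) : Mat p 2) 1 0 * (a : Mat p 2) 0 0 = 0 := by
      rw [Units.val_mul, Matrix.mul_apply, Fin.sum_univ_two, ha0, mul_zero, add_zero] at e1
      exact e1
    exact (mul_eq_zero.mp e).resolve_right (diag_ne_zero_of_upper ha0).1
  · exact fun s hs => hs.1
  · exact fun s hs => hs.2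
  · exact fun s hs h0 => ⟨hs, h0⟩

omit hp in
/-- Floor arithmetic: `p²(p²-1) ≤ 1 + p³ + (p-2)(p+1)³` for `p ≥ 3`
(margin `2p³ - 2p² - 5p - 1`). -/
theorem sq_mul_pred_mul_succ_le_floor (hp3 : 3 ≤ p) :
    p * p * ((p - 1) * (p + 1)) ≤ 1 + p ^ 3 + (p - 2) * (p + 1) ^ 3 := by
  obtain ⟨q, rfl⟩ : ∃ q, p = q + 3 := ⟨p - 3, by omega⟩
  have e1 : q + 3 - 1 = q + 2 := by omega
  have e2 : q + 3 - 2 = q + 1 := by omega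
  rw [e1, e2]
  exact Nat.le.intro (k := 2 * q ^ 3 + 16 * q ^ 2 + 37 * q + 20) (by ring)

omit hp in
/-- Floor arithmetic: `p(p+1)²(p-1) ≤ 1 + p³ + (p-2)(p+1)³` for `p ≥ 5`
(margin `p³ - 2p² - 4p - 1`; it fails at `p = 3` by `4`). -/
theorem mul_succ_sq_mul_pred_le_floor (hp5 : 5 ≤ p) :
    p * ((p + 1) * (p + 1)) * (p - 1) ≤ 1 + p ^ 3 + (p - 2) * (p + 1) ^ 3 := by
  obtain ⟨q, rfl⟩ : ∃ q, p = q + 5 := ⟨p - 5, by omega⟩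
  have e1 : q + 5 - 1 = q + 4 := by omega
  have e2 : q + 5 - 2 = q + 3 := by omega
  rw [e1, e2]
  exact Nat.le.intro (k := q ^ 3 + 13 * q ^ 2 + 51 * q + 54) (by ring)

end ProjectiveLine

end Summit.MatrixMultiplication.MatrixMultiplication.Theorems.SubgroupIdentityDesigns.Negative

end
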